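import Summits.QuantumFields.YangMills.Theorems.VirialFluxGapFixSliceDefs
import HarnessLib

/-!
# The Cor-B LETTERS of the slice map — definitions
# (layer (B2)/(b) of the DIRECT Laplace road to ⟨stmt-QuantumFields-24204⟩ `VirialFluxGap.SharpTwistedLaplace`)

Definitions module (free-hands work of width seat ym-line-sfw-p2-w2 g50, cell ym-idea-1; `--supports 24204`).  The slice map
✓`FixSplit.fixSlice ωC ωN ωX C₀ N₀ R y` (w3 g57) moves every component of the base ring by a LEFT exponential factor; the phase model
✓`ChartPhase.abs_ringDeficit_sub_chartModel_le` (w3 g56) and the coercivity theorem ✓`AnchorSlice.ringDeficit_quadratic_growth_anchorSlice` (this seat)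
are written in terms of these left-chart exponents («Cor-B letters»).  Here they are named, as functions of the slice coordinates
`y : ℝ³ × RestParam L e₀ y₀`:
* `sliceLetterA ωN ωX y : Fin (2L−1+1) → Edge 3 L → ℍ` — slice `0`: `0` on tree links, `ι(y.1 1·ω_N + y.1 2·ω_×)` at the anchor link `e₀`,
  `ι(y.2.1 i)` at the other off-tree links; slices `j+1`: `ι(y.2.2.1 j e)` (`ι = imQuat`);
* `sliceLetterB ωC y : Site 3 L → ℍ` — `ι(y.1 0·ω_C)` at the anchor site `y₀`, `ι(y.2.2.2 x)` elsewhere.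
So that `su2Quat((ι σ(y))_{i,e}) = exp(sliceLetterA y i e)·su2Quat(combFlat w_s e)` and `su2Quat(σ(y).2.2 x) = exp(sliceLetterB y x)·su2Quat(λ_x C₀)`
(proved in the sequel `VirialFluxGapFixSliceLetters`).  HONEST FRAMING: definitions only; nothing about ⟨24204⟩ is proved here; the Yang–Mills
mass gap is NOT proved; no summit is proved by a line.

## References
* M. Lüscher, Nucl. Phys. B219 (1983), §2 (expansion around twist-eating flat connections). [Luscher1983]
* G. E. Bredon, *Introduction to Compact Transformation Groups* (1972), Ch. II §§4–5. [Bredon1972]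
-/

set_option autoImplicit false

noncomputable section

open scoped Quaternion
open Literature.MathematicalPhysics.QuantumFieldTheory hiding SU2
open Literature.MathematicalPhysics.QuantumFieldTheory.Balaban1983to89.T4HaarSU2ExpChart
open Summit.QuantumFields.YangMills.Theorems.FemtoTransferGap
open Summit.QuantumFields.YangMills.Theorems.FemtoTransferGap.TT
open Summit.QuantumFields.YangMills.Theorems.VirialFluxGap.FixSplit

namespace Summit.QuantumFields.YangMills.Theorems.VirialFluxGap.AnchorSlice

variable {L : ℕ} [NeZero L]

/-- **Cor-B letters, link part.**  The left-chart exponents of the link components of the slice point `σ(y)`: on slice `0` they vanish on tree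
links (tree gauge), equal `ι(y.1 1·ω_N + y.1 2·ω_×)` at the anchor link `e₀` and `ι(y.2.1 i)` at the other off-tree links; on slice `j+1` they are
`ι(y.2.2.1 j e)`. [cite: Luscher1983, §2] [cite: Bredon1972, Ch. II §4] -/
def sliceLetterA (ωN ωX : EuclideanSpace ℝ (Fin 3)) {e₀ : OffIdx L} {y₀ : Site 3 L} (y : EuclideanSpace ℝ (Fin 3) × RestParam L e₀ y₀) :
    Fin (2 * L - 1 + 1) → Edge 3 L → ℍ :=
  Fin.cons
    (fun e => if he : treeEdge e = true then 0 else
      (if hi : (⟨e, he⟩ : OffIdx L) = e₀ then imQuat ((y.1 1) • ωN + (y.1 2) • ωX) else imQuat (y.2.1 ⟨⟨e, he⟩, hi⟩)))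
    (fun j e => imQuat (y.2.2.1 j e))

/-- **Cor-B letters, seam part.**  The left-chart exponents of the seam components of `σ(y)`: `ι(y.1 0·ω_C)` at the anchor site `y₀`, `ι(y.2.2.2 x)`
at the other sites. [cite: Luscher1983, §2] [cite: Bredon1972, Ch. II §4] -/
def sliceLetterB (ωC : EuclideanSpace ℝ (Fin 3)) {e₀ : OffIdx L} {y₀ : Site 3 L} (y : EuclideanSpace ℝ (Fin 3) × RestParam L e₀ y₀) :
    Site 3 L → ℍ :=
  fun x => if hx : x = y₀ then imQuat ((y.1 0) • ωC) else imQuat (y.2.2.2 ⟨x, hx⟩)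

end Summit.QuantumFields.YangMills.Theorems.VirialFluxGap.AnchorSlice
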